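/-
Copyright (c) 2026 the pub-hodgecm-mathlib formalisation cell (harness21).  Prover seat hodgecm-mathlib-K2E3-p28 (g2), HCML Track B «K2-LIT» ∕ h413
(`stmt-HodgeConjecture-24833`), R90-TF section S3 hand S3-p10 «h6 → h3» (dealt BY NAME by R90-C12-plan (g0), 2026-09-04T21:56:32Z).  2026-09-04.
-/
import Mathlib.NumberTheory.NumberField.CMField
import HarnessLib

/-!
# R90-TF rung 0, token `h3` — a CM field of degree `≥ 6` has maximal real subfield of degree `≥ 3`

Cell `pub/hodgecm-mathlib` (D-0151), Track B (21-frontier RULING «PUSH BOTH» 2026-09-03, director req624), seat K2E3-p28 (g2), section S3 (dealer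
R90-C12-plan (g0)), hand S3-p10.  `--supports stmt-HodgeConjecture-24833 --as helper`; THEOREMS ONLY (no definition ∕ instance ∕ notation ∕ named fact ∕ `sorry`);
Mathlib-only imports; never imports `Cruxes/…/Lines`.

PURPOSE.  LEAD #30 (B) (R90-TF, 2026-09-04) discharges the R-QS1-7 token `(h3 : 3 ≤ Module.finrank ℚ ↥(maximalRealSubfield L))` of the rung-0 sockets from the
hypothesis `h6 : 6 ≤ Module.finrank ℚ L` of `Hyp413` by the tower law; this file is the ONE cell-wide name for that discharge (S3-R9, S7 O2″, S9-J7, LH10 ED. 10 cite it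
instead of inlining five copies).

MATHEMATICS (size S).  For a CM field `L` with maximal real subfield `L⁺ = maximalRealSubfield L`, `L ∕ L⁺` is quadratic (`Algebra.IsQuadraticExtension L⁺ L`, the Mathlib
instance `NumberField.IsCMField.isQuadraticExtension`), so `[L⁺ : ℚ] · [L : L⁺] = [L : ℚ]` (`Module.finrank_mul_finrank`) reads `[L⁺ : ℚ] · 2 = [L : ℚ] ≥ 6`, whence `[L⁺ : ℚ] ≥ 3`.
Kernel bytes = R90-C12-plan (g0)'s read-only probe `R90/R90-C12-plan/g0/ProbeH3OfH6.C12plan-g0.lean` (sha16 b2285463355f62dc, farm rc 0) re-headed as a Theorems file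
(namespace `…R90`, Mathlib-only imports).
HONEST LABEL: a degree inequality — it proves nothing printed; HC_CM is proved only modulo the 7 printed citations (2 remaining named inputs: hLiu418 =
stmt-HodgeConjecture-24832, h413 = stmt-HodgeConjecture-24833) until rung 0 closes; count-neutral helper.
-/

namespace Summit.HodgeConjecture.HodgeConjecture.R90

open NumberField

/-- **Token `h3` from `h6` (R90-TF LEAD #30 (B), R-QS1-7).**  If `L` is a CM field with `6 ≤ [L : ℚ]`, then its maximal real subfield `L⁺` has `3 ≤ [L⁺ : ℚ]`:
tower law `[L⁺ : ℚ] · [L : L⁺] = [L : ℚ]` with `[L : L⁺] = 2` (`L ∕ L⁺` is a quadratic extension for a CM field). -/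
theorem three_le_finrank_maximalRealSubfield_of_six_le (L : Type) [Field L] [NumberField L] [IsCMField L]
    (h6 : 6 ≤ Module.finrank ℚ L) : 3 ≤ Module.finrank ℚ ↥(maximalRealSubfield L) := by
  have htower := Module.finrank_mul_finrank ℚ ↥(maximalRealSubfield L) L
  have h2 : Module.finrank ↥(maximalRealSubfield L) L = 2 :=
    Algebra.IsQuadraticExtension.finrank_eq_two ↥(maximalRealSubfield L) L
  rw [h2] at htower
  omega

end Summit.HodgeConjecture.HodgeConjecture.R90
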